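/-
Copyright (c) 2026 the pub-hodgecm-mathlib formalisation cell (harness21).  Prover seat hodgecm-mathlib-K2Liu-p09 (g2): Track B «K2-LIT»,
#184♮ = hLiu418 = stmt-HodgeConjecture-24832, unit U5b «LOCAL SEAM OF s23», socket #29s `sig_K2LiuDoublingPartialEuler`, file (C0b):
the BOX FORMULA of the vector-twisted Euler factorisation; 2026-09-04.
-/
import Summits.HodgeConjecture.HodgeConjecture.Theorems.K2LiuDoublingZetaPlaceSplitting    -- ★ p04 (g2): `ν ≅ ν_∞ ⊗ (ν_S ⊗ ν^S)`, Fubini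
import Summits.HodgeConjecture.HodgeConjecture.Theorems.K2LiuDoublingHeckeIteration        -- ★ (A): iterated local Hecke identities
import Literature.NumberTheory.Automorphic.UnitaryGroupPureTensorEulerProduct              -- ★ `secondCountableTopology_localPi`, `locallyCompactSpace_localPi`
import Literature.MeasureTheory.RestrictedProduct.ProductIntegral                          -- ★ `integral_comp_glue_prod`
import HarnessLib

/-!
# Crux `HLiu418`, Track B road `K2_Liu`, unit U5b «LOCAL SEAM OF s23», socket #29s — file (C0b):
# THE BOX FORMULA `∫_{A_T} (∏ᶠ_v Λ_v(y_v)) Q(t · j(y)) d∏'(ν_v; K_v) = (∏_{v∈T} c_v) · Q(t)`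

Cell `hodgecm-mathlib`, crux item hLiu418 = `stmt-HodgeConjecture-24832`; squad K2 ∕ K2Liu, prover K2Liu-p09 (g2).  THEOREMS ONLY; lane
`--supports stmt-HodgeConjecture-24832` (helper for socket #29s `sig_K2LiuDoublingPartialEuler`).  Generic `F E c N J` (CM datum: `F = L⁺, E = L`, `c` = complex
conjugation, `J = H`).

* §2 components of `(x_∞, 1)·(1, ι_S x_S)·(1, ι^S y)` and of `j(y) = (1, ι^S y)` (★ `splitPlaces`, ★ `archPart ∕ finPart ∕ evalPlace`); the (K)-invariance step
  `apply_mul_jY_eq_of_forall_mem` and the (F)-factorisation step `apply_pe_mul_jY_eq` of socket #29s's hypotheses.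
* §3 `setIntegral_rpBox_eq` — THE BOX FORMULA: for a bounded measurable `Q` on `U(J)(𝔸_F)` invariant under the compact factor `Π_v K_v` off `S` on the right
  (hypothesis (K)), local kernels `Λ_v ∈ L¹(ν_v)` with `Λ_v|K_v = 1`, and the local Hecke identities (E) off `S`:
  `∫_{A_T} (∏ᶠ_v Λ_v(y_v)) · Q(t · j(y)) d∏'_{v∉S}(ν_v; K_v)(y) = (∏_{v∈T} c_v) · Q(t)` for every finite `T ⊆ {v ∉ S}` (`A_T` = the box
  `Π_{v∈T} U(J)(F_v) × Π_{v∉T} K_v`; ★ `integral_comp_glue_prod` + ★ (A) `integral_prod_mul_eq`, transported to the index type `{v // v ∉ S}` in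
  `integral_prod_mul_eq_subtype`).
[Tate, Cassels–Fröhlich Ch. XV §3.3 Thm 3.3.1; Liu (2011) §2B Prop. 2.3; Borel–Jacquet (1979) §4.1.]

HONEST LABEL.  Helper of socket #29s; by itself it retires no named input: `HC_CM` is proved only modulo the 7 printed citations (2 remaining named
inputs: hLiu418 = `stmt-HodgeConjecture-24832`, h413 = `stmt-HodgeConjecture-24833`) until rung 0 closes.
-/

set_option autoImplicit false
-- the mandated namespace repeats the single-problem summit's segment (`HodgeConjecture.HodgeConjecture`)
set_option linter.dupNamespace false

noncomputable section

open scoped RestrictedProduct ENNReal NNReal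
open NumberField IsDedekindDomain MeasureTheory Measure

namespace Summit.HodgeConjecture.HodgeConjecture.Cruxes.HLiu418.K2LiuDoublingEulerBox

open Literature.NumberTheory.Automorphic
open Literature.NumberTheory.K2Lit.PlaceSplitting
open Literature.MeasureTheory.RestrictedProduct
open Summit.HodgeConjecture.HodgeConjecture.Cruxes.HLiu418.K2LiuAdelicPlaceSplittingFubini
open Summit.HodgeConjecture.HodgeConjecture.Cruxes.HLiu418.K2LiuDoublingZetaPlaceSplitting
open Summit.HodgeConjecture.HodgeConjecture.Cruxes.HLiu418.K2LiuDoublingHeckeIteration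

variable (F E : Type) [Field F] [NumberField F] [Field E] [NumberField E] [Algebra F E]
  (c : E ≃ₐ[F] E) (N : ℕ) (J : Matrix (Fin N) (Fin N) E)
  (S : Finset (HeightOneSpectrum (𝓞 F))) [DecidableEq (HeightOneSpectrum (𝓞 F))]

/-! ## §2 Components of `(x_∞, 1)·(1, ι_S x_S)` and of `j(y) = (1, ι^S y)`; the (K)-invariance and (F)-factorisation steps -/

section Components

/-- Components at `v ∈ S` of `splitPlaces⁻¹ (x, y)`. [cite: PlatonovRapinchuk1994, §5.1] -/
theorem evalPlace_splitPlaces_symm_of_mem (x : Π v : S, UnitaryGroup.localPi E c N J v.1) (y : (Πʳ v : {v // v ∉ S}, [UnitaryGroup.localPi E c N J v.1, UnitaryGroup.localInt E c N J v.1])) (v : S) :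
    UnitaryGroup.evalPlace F E c N J v.1 ((splitPlaces F E c N J S).symm (x, y)) = x v := by
  rw [← splitPlaces_fst_apply F E c N J S, ContinuousMulEquiv.apply_symm_apply]

/-- Components at `v ∉ S` of `splitPlaces⁻¹ (x, y)`. [cite: PlatonovRapinchuk1994, §5.1] -/
theorem evalPlace_splitPlaces_symm_of_not_mem (x : Π v : S, UnitaryGroup.localPi E c N J v.1) (y : (Πʳ v : {v // v ∉ S}, [UnitaryGroup.localPi E c N J v.1, UnitaryGroup.localInt E c N J v.1])) (v : {v // v ∉ S}) :
    UnitaryGroup.evalPlace F E c N J v.1 ((splitPlaces F E c N J S).symm (x, y)) = y v := by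
  rw [← splitPlaces_snd_apply F E c N J S, ContinuousMulEquiv.apply_symm_apply]

/-- `j` is multiplicative: `j(y y') = j(y) j(y')`. [cite: BorelJacquet1979, §4.1] -/
theorem jY_mul (y y' : (Πʳ v : {v // v ∉ S}, [UnitaryGroup.localPi E c N J v.1, UnitaryGroup.localInt E c N J v.1])) :
    UnitaryGroup.finAdelicToAdelic F E c N J ((splitPlaces F E c N J S).symm (1, y * y')) =
      UnitaryGroup.finAdelicToAdelic F E c N J ((splitPlaces F E c N J S).symm (1, y)) *
        UnitaryGroup.finAdelicToAdelic F E c N J ((splitPlaces F E c N J S).symm (1, y')) := by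
  rw [← (UnitaryGroup.finAdelicToAdelic F E c N J).map_mul, ← map_mul, Prod.mk_mul_mk, mul_one]

/-- `j(y⁻¹) = j(y)⁻¹`. [cite: BorelJacquet1979, §4.1] -/
theorem jY_inv (y : (Πʳ v : {v // v ∉ S}, [UnitaryGroup.localPi E c N J v.1, UnitaryGroup.localInt E c N J v.1])) :
    UnitaryGroup.finAdelicToAdelic F E c N J ((splitPlaces F E c N J S).symm (1, y⁻¹)) =
      (UnitaryGroup.finAdelicToAdelic F E c N J ((splitPlaces F E c N J S).symm (1, y)))⁻¹ := by
  rw [← (UnitaryGroup.finAdelicToAdelic F E c N J).map_inv, ← map_inv, Prod.inv_mk, inv_one]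

/-- **The (K)-step.**  If `Q` is invariant on the right under elements with archimedean part `1`, all finite components in `K_v` and `= 1` on `S`
(hypothesis (K) of socket #29s), then `Q(t · j(z)) = Q(t)` for every `z ∈ ∏'_{v∉S}` all of whose components lie in `K_v`.
[cite: Liu2011, §2B Prop. 2.3 p. 862] -/
theorem apply_mul_jY_eq_of_forall_mem (Q : (UnitaryGroup.adelicGroupData F E c N J).Adelic → ℂ)
    (hK : ∀ t k : (UnitaryGroup.adelicGroupData F E c N J).Adelic, UnitaryGroup.archPart F E c N J k = 1 →
      (∀ v, UnitaryGroup.evalPlace F E c N J v (UnitaryGroup.finPart F E c N J k) ∈ UnitaryGroup.localInt E c N J v) →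
      (∀ v ∈ S, UnitaryGroup.evalPlace F E c N J v (UnitaryGroup.finPart F E c N J k) = 1) → Q (t * k) = Q t)
    (z : (Πʳ v : {v // v ∉ S}, [UnitaryGroup.localPi E c N J v.1, UnitaryGroup.localInt E c N J v.1])) (hz : ∀ v, z v ∈ UnitaryGroup.localInt E c N J v.1) (t : (UnitaryGroup.adelicGroupData F E c N J).Adelic) :
    Q (t * UnitaryGroup.finAdelicToAdelic F E c N J ((splitPlaces F E c N J S).symm (1, z))) = Q t := by
  refine hK t _ (UnitaryGroup.archPart_finAdelicToAdelic F E c N J _) (fun v => ?_) (fun v hv => ?_)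
  · rw [UnitaryGroup.finPart_finAdelicToAdelic]
    by_cases hv : v ∈ S
    · rw [evalPlace_splitPlaces_symm_of_mem F E c N J S 1 z ⟨v, hv⟩, Pi.one_apply]
      exact (UnitaryGroup.localInt E c N J v).one_mem
    · rw [evalPlace_splitPlaces_symm_of_not_mem F E c N J S 1 z ⟨v, hv⟩]
      exact hz ⟨v, hv⟩
  · rw [UnitaryGroup.finPart_finAdelicToAdelic, evalPlace_splitPlaces_symm_of_mem F E c N J S 1 z ⟨v, hv⟩, Pi.one_apply]

/-- Archimedean part of `(x_∞, 1)·(1, ι_S x_S)`: it is `x_∞`. [cite: BorelJacquet1979, §4.1] -/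
theorem archPart_pe (a : UnitaryGroup.arch F E c N J) (x : Π v : S, UnitaryGroup.localPi E c N J v.1) :
    UnitaryGroup.archPart F E c N J (UnitaryGroup.archToAdelic F E c N J a *
      UnitaryGroup.finAdelicToAdelic F E c N J ((splitPlaces F E c N J S).symm (x, 1))) = a := by
  rw [(UnitaryGroup.archPart F E c N J).map_mul, UnitaryGroup.archPart_archToAdelic, UnitaryGroup.archPart_finAdelicToAdelic, mul_one]

/-- Components at `v ∈ S` of `(x_∞, 1)·(1, ι_S x_S)`: `x_v`. [cite: BorelJacquet1979, §4.1] -/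
theorem evalPlace_pe_of_mem (a : UnitaryGroup.arch F E c N J) (x : Π v : S, UnitaryGroup.localPi E c N J v.1) (v : S) :
    UnitaryGroup.evalPlace F E c N J v.1 (UnitaryGroup.finPart F E c N J (UnitaryGroup.archToAdelic F E c N J a *
      UnitaryGroup.finAdelicToAdelic F E c N J ((splitPlaces F E c N J S).symm (x, 1)))) = x v := by
  rw [(UnitaryGroup.finPart F E c N J).map_mul, UnitaryGroup.finPart_archToAdelic, UnitaryGroup.finPart_finAdelicToAdelic, one_mul,
    evalPlace_splitPlaces_symm_of_mem]

/-- Components at `v ∉ S` of `(x_∞, 1)·(1, ι_S x_S)`: `1`. [cite: BorelJacquet1979, §4.1] -/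
theorem evalPlace_pe_of_not_mem (a : UnitaryGroup.arch F E c N J) (x : Π v : S, UnitaryGroup.localPi E c N J v.1) (v : {v // v ∉ S}) :
    UnitaryGroup.evalPlace F E c N J v.1 (UnitaryGroup.finPart F E c N J (UnitaryGroup.archToAdelic F E c N J a *
      UnitaryGroup.finAdelicToAdelic F E c N J ((splitPlaces F E c N J S).symm (x, 1)))) = 1 := by
  rw [(UnitaryGroup.finPart F E c N J).map_mul, UnitaryGroup.finPart_archToAdelic, UnitaryGroup.finPart_finAdelicToAdelic, one_mul,
    evalPlace_splitPlaces_symm_of_not_mem, RestrictedProduct.one_apply]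

/-- Archimedean part of `(x_∞, 1)·(1, ι_S x_S)·(1, ι^S y)`: it is `x_∞`. [cite: BorelJacquet1979, §4.1] -/
theorem archPart_pe_mul_jY (a : UnitaryGroup.arch F E c N J) (x : Π v : S, UnitaryGroup.localPi E c N J v.1) (y : (Πʳ v : {v // v ∉ S}, [UnitaryGroup.localPi E c N J v.1, UnitaryGroup.localInt E c N J v.1])) :
    UnitaryGroup.archPart F E c N J (UnitaryGroup.archToAdelic F E c N J a *
      UnitaryGroup.finAdelicToAdelic F E c N J ((splitPlaces F E c N J S).symm (x, 1)) *
        UnitaryGroup.finAdelicToAdelic F E c N J ((splitPlaces F E c N J S).symm (1, y))) = a := by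
  rw [(UnitaryGroup.archPart F E c N J).map_mul, archPart_pe, UnitaryGroup.archPart_finAdelicToAdelic, mul_one]

/-- Components at `v ∈ S` of `(x_∞, 1)·(1, ι_S x_S)·(1, ι^S y)`: `x_v`. [cite: BorelJacquet1979, §4.1] -/
theorem evalPlace_pe_mul_jY_of_mem (a : UnitaryGroup.arch F E c N J) (x : Π v : S, UnitaryGroup.localPi E c N J v.1) (y : (Πʳ v : {v // v ∉ S}, [UnitaryGroup.localPi E c N J v.1, UnitaryGroup.localInt E c N J v.1])) (v : S) :
    UnitaryGroup.evalPlace F E c N J v.1 (UnitaryGroup.finPart F E c N J (UnitaryGroup.archToAdelic F E c N J a *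
      UnitaryGroup.finAdelicToAdelic F E c N J ((splitPlaces F E c N J S).symm (x, 1)) *
        UnitaryGroup.finAdelicToAdelic F E c N J ((splitPlaces F E c N J S).symm (1, y)))) = x v := by
  rw [(UnitaryGroup.finPart F E c N J).map_mul, (UnitaryGroup.evalPlace F E c N J v.1).map_mul, evalPlace_pe_of_mem,
    UnitaryGroup.finPart_finAdelicToAdelic, evalPlace_splitPlaces_symm_of_mem, Pi.one_apply, mul_one]

/-- Components at `v ∉ S` of `(x_∞, 1)·(1, ι_S x_S)·(1, ι^S y)`: `y_v`. [cite: BorelJacquet1979, §4.1] -/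
theorem evalPlace_pe_mul_jY_of_not_mem (a : UnitaryGroup.arch F E c N J) (x : Π v : S, UnitaryGroup.localPi E c N J v.1) (y : (Πʳ v : {v // v ∉ S}, [UnitaryGroup.localPi E c N J v.1, UnitaryGroup.localInt E c N J v.1])) (v : {v // v ∉ S}) :
    UnitaryGroup.evalPlace F E c N J v.1 (UnitaryGroup.finPart F E c N J (UnitaryGroup.archToAdelic F E c N J a *
      UnitaryGroup.finAdelicToAdelic F E c N J ((splitPlaces F E c N J S).symm (x, 1)) *
        UnitaryGroup.finAdelicToAdelic F E c N J ((splitPlaces F E c N J S).symm (1, y)))) = y v := by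
  rw [(UnitaryGroup.finPart F E c N J).map_mul, (UnitaryGroup.evalPlace F E c N J v.1).map_mul, evalPlace_pe_of_not_mem,
    UnitaryGroup.finPart_finAdelicToAdelic, evalPlace_splitPlaces_symm_of_not_mem, one_mul]

/-- **The (F)-step.**  If `φ` factors as in hypothesis (F) of socket #29s (`φ(t) = FS(t_∞, t_S) · ∏ᶠ_{v∉S} Λ_v(t_v)`) with `Λ_v|K_v = 1`, then along the gluing
`φ((x_∞,1)(1,ι_S x_S)(1,ι^S y)) = φ((x_∞,1)(1,ι_S x_S)) · ∏ᶠ_{v∉S} Λ_v(y_v)`. [cite: Liu2011, §2B Prop. 2.3 p. 862] [cite: CasselsFrohlichANT1967, Ch. XV (Tate) §3.3] -/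
theorem apply_pe_mul_jY_eq (φ : (UnitaryGroup.adelicGroupData F E c N J).Adelic → ℂ)
    (FS : UnitaryGroup.arch F E c N J × (Π v : S, UnitaryGroup.localPi E c N J v.1) → ℂ)
    (Λ : ∀ v : HeightOneSpectrum (𝓞 F), UnitaryGroup.localPi E c N J v → ℂ)
    (hF : ∀ t : (UnitaryGroup.adelicGroupData F E c N J).Adelic, φ t = FS (UnitaryGroup.archPart F E c N J t,
        fun v : S => UnitaryGroup.evalPlace F E c N J v.1 (UnitaryGroup.finPart F E c N J t)) *
      ∏ᶠ v : {v : HeightOneSpectrum (𝓞 F) // v ∉ S}, Λ v.1 (UnitaryGroup.evalPlace F E c N J v.1 (UnitaryGroup.finPart F E c N J t)))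
    (hΛK : ∀ v, v ∉ S → ∀ k ∈ UnitaryGroup.localInt E c N J v, Λ v k = 1)
    (a : UnitaryGroup.arch F E c N J) (x : Π v : S, UnitaryGroup.localPi E c N J v.1) (y : (Πʳ v : {v // v ∉ S}, [UnitaryGroup.localPi E c N J v.1, UnitaryGroup.localInt E c N J v.1])) :
    φ (UnitaryGroup.archToAdelic F E c N J a * UnitaryGroup.finAdelicToAdelic F E c N J ((splitPlaces F E c N J S).symm (x, 1)) *
        UnitaryGroup.finAdelicToAdelic F E c N J ((splitPlaces F E c N J S).symm (1, y))) =
      φ (UnitaryGroup.archToAdelic F E c N J a * UnitaryGroup.finAdelicToAdelic F E c N J ((splitPlaces F E c N J S).symm (x, 1))) *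
        ∏ᶠ v : {v : HeightOneSpectrum (𝓞 F) // v ∉ S}, Λ v.1 (y v) := by
  have h1S : (fun v : S => UnitaryGroup.evalPlace F E c N J v.1 (UnitaryGroup.finPart F E c N J (UnitaryGroup.archToAdelic F E c N J a *
      UnitaryGroup.finAdelicToAdelic F E c N J ((splitPlaces F E c N J S).symm (x, 1)) *
        UnitaryGroup.finAdelicToAdelic F E c N J ((splitPlaces F E c N J S).symm (1, y))))) = x :=
    funext fun v => evalPlace_pe_mul_jY_of_mem F E c N J S a x y v
  have h0S : (fun v : S => UnitaryGroup.evalPlace F E c N J v.1 (UnitaryGroup.finPart F E c N J (UnitaryGroup.archToAdelic F E c N J a *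
      UnitaryGroup.finAdelicToAdelic F E c N J ((splitPlaces F E c N J S).symm (x, 1))))) = x :=
    funext fun v => evalPlace_pe_of_mem F E c N J S a x v
  have hL : φ (UnitaryGroup.archToAdelic F E c N J a * UnitaryGroup.finAdelicToAdelic F E c N J ((splitPlaces F E c N J S).symm (x, 1)) *
        UnitaryGroup.finAdelicToAdelic F E c N J ((splitPlaces F E c N J S).symm (1, y))) = FS (a, x) * ∏ᶠ v : {v : HeightOneSpectrum (𝓞 F) // v ∉ S}, Λ v.1 (y v) := by
    rw [hF, archPart_pe_mul_jY, h1S]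
    exact congrArg _ (finprod_congr fun v => by rw [evalPlace_pe_mul_jY_of_not_mem])
  have hR : φ (UnitaryGroup.archToAdelic F E c N J a * UnitaryGroup.finAdelicToAdelic F E c N J ((splitPlaces F E c N J S).symm (x, 1))) = FS (a, x) := by
    rw [hF, archPart_pe, h0S, finprod_eq_one_of_forall_eq_one, mul_one]
    intro v
    rw [evalPlace_pe_of_not_mem]
    exact hΛK v.1 v.2 _ (UnitaryGroup.localInt E c N J v.1).one_mem
  rw [hL, hR]

end Components


/-! ## §3 The box formula -/

section Box

variable [MeasurableSpace (UnitaryGroup.adelicGroupData F E c N J).Adelic] [BorelSpace (UnitaryGroup.adelicGroupData F E c N J).Adelic]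
  [∀ v : HeightOneSpectrum (𝓞 F), MeasurableSpace (UnitaryGroup.localPi E c N J v)] [∀ v : HeightOneSpectrum (𝓞 F), BorelSpace (UnitaryGroup.localPi E c N J v)]

omit [MeasurableSpace (UnitaryGroup.adelicGroupData F E c N J).Adelic] [BorelSpace (UnitaryGroup.adelicGroupData F E c N J).Adelic] [∀ v, MeasurableSpace (UnitaryGroup.localPi E c N J v)] [∀ v, BorelSpace (UnitaryGroup.localPi E c N J v)] in
/-- On the box `A_T`, the kernel `∏ᶠ_v Λ_v(y_v)` is the finite product over `T` (the other components lie in `K_v`, where `Λ_v = 1`).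
[cite: CasselsFrohlichANT1967, Ch. XV (Tate) §3.3 Thm. 3.3.1] -/
theorem finprod_glue_eq (Λ : ∀ v : HeightOneSpectrum (𝓞 F), UnitaryGroup.localPi E c N J v → ℂ) (hΛK : ∀ v, v ∉ S → ∀ k ∈ UnitaryGroup.localInt E c N J v, Λ v k = 1)
    (T : Finset {v : HeightOneSpectrum (𝓞 F) // v ∉ S})
    (p : (Π v : {v : {v : HeightOneSpectrum (𝓞 F) // v ∉ S} // v ∈ T}, UnitaryGroup.localPi E c N J v.1.1) ×
      (Π v : {v : {v : HeightOneSpectrum (𝓞 F) // v ∉ S} // v ∉ T}, (fun v : {v // v ∉ S} => (UnitaryGroup.localInt E c N J v.1 : Set (UnitaryGroup.localPi E c N J v.1))) v.1)) :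
    (∏ᶠ v : {v : HeightOneSpectrum (𝓞 F) // v ∉ S}, Λ v.1 (glue (fun v : {v // v ∉ S} => (UnitaryGroup.localInt E c N J v.1 : Set (UnitaryGroup.localPi E c N J v.1))) T p v)) = ∏ v : {v : {v : HeightOneSpectrum (𝓞 F) // v ∉ S} // v ∈ T}, Λ v.1.1 (p.1 v) := by
  rw [finprod_eq_prod_of_mulSupport_subset (s := T) _ fun v hv => ?_, ← Finset.prod_coe_sort]
  · exact Fintype.prod_congr _ _ fun v => by rw [glue_apply_of_mem (fun v : {v // v ∉ S} => (UnitaryGroup.localInt E c N J v.1 : Set (UnitaryGroup.localPi E c N J v.1))) T p v.2]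
  · by_contra hvT
    refine hv ?_
    show Λ v.1 _ = 1
    rw [glue_apply_of_not_mem (fun v : {v // v ∉ S} => (UnitaryGroup.localInt E c N J v.1 : Set (UnitaryGroup.localPi E c N J v.1))) T p hvT]
    exact hΛK v.1 v.2 _ (p.2 ⟨v, hvT⟩).2

omit [MeasurableSpace (UnitaryGroup.adelicGroupData F E c N J).Adelic] [BorelSpace (UnitaryGroup.adelicGroupData F E c N J).Adelic] [∀ v, MeasurableSpace (UnitaryGroup.localPi E c N J v)] [∀ v, BorelSpace (UnitaryGroup.localPi E c N J v)] in
set_option maxHeartbeats 400000 in -- measured: > 200 000 (restricted-product group rewriting); no search tactics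
/-- **The (K)-step on the box**: `Q(t · j(glue(w, k))) = Q(t · j(glue(w, 1)))` — the `K`-part `k` of the box is absorbed by the invariance (K).
[cite: Liu2011, §2B Prop. 2.3 p. 862] -/
theorem apply_glue_eq (Q : (UnitaryGroup.adelicGroupData F E c N J).Adelic → ℂ)
    (hK : ∀ t k : (UnitaryGroup.adelicGroupData F E c N J).Adelic, UnitaryGroup.archPart F E c N J k = 1 →
      (∀ v, UnitaryGroup.evalPlace F E c N J v (UnitaryGroup.finPart F E c N J k) ∈ UnitaryGroup.localInt E c N J v) →
      (∀ v ∈ S, UnitaryGroup.evalPlace F E c N J v (UnitaryGroup.finPart F E c N J k) = 1) → Q (t * k) = Q t)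
    (T : Finset {v : HeightOneSpectrum (𝓞 F) // v ∉ S}) (w : Π v : {v : {v : HeightOneSpectrum (𝓞 F) // v ∉ S} // v ∈ T}, UnitaryGroup.localPi E c N J v.1.1)
    (k : Π v : {v : {v : HeightOneSpectrum (𝓞 F) // v ∉ S} // v ∉ T}, (fun v : {v // v ∉ S} => (UnitaryGroup.localInt E c N J v.1 : Set (UnitaryGroup.localPi E c N J v.1))) v.1) (t : (UnitaryGroup.adelicGroupData F E c N J).Adelic) :
    Q (t * UnitaryGroup.finAdelicToAdelic F E c N J ((splitPlaces F E c N J S).symm (1, glue (fun v : {v // v ∉ S} => (UnitaryGroup.localInt E c N J v.1 : Set (UnitaryGroup.localPi E c N J v.1))) T (w, k)))) =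
      Q (t * UnitaryGroup.finAdelicToAdelic F E c N J ((splitPlaces F E c N J S).symm
        (1, glue (fun v : {v // v ∉ S} => (UnitaryGroup.localInt E c N J v.1 : Set (UnitaryGroup.localPi E c N J v.1))) T (w, fun v => ⟨1, (UnitaryGroup.localInt E c N J v.1.1).one_mem⟩)))) := by
  obtain ⟨y₁, hy₁⟩ : ∃ y₁ : (Πʳ v : {v // v ∉ S}, [UnitaryGroup.localPi E c N J v.1, UnitaryGroup.localInt E c N J v.1]), y₁ = glue (fun v : {v // v ∉ S} => (UnitaryGroup.localInt E c N J v.1 : Set (UnitaryGroup.localPi E c N J v.1))) T (w, fun v => ⟨1, (UnitaryGroup.localInt E c N J v.1.1).one_mem⟩) := ⟨_, rfl⟩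
  rw [← hy₁]
  have hz : ∀ v, (y₁⁻¹ * glue (fun v : {v // v ∉ S} => (UnitaryGroup.localInt E c N J v.1 : Set (UnitaryGroup.localPi E c N J v.1))) T (w, k)) v ∈ UnitaryGroup.localInt E c N J v.1 := by
    intro v
    rw [RestrictedProduct.mul_apply, RestrictedProduct.inv_apply]
    by_cases hv : v ∈ T
    · rw [hy₁, glue_apply_of_mem (fun v : {v // v ∉ S} => (UnitaryGroup.localInt E c N J v.1 : Set (UnitaryGroup.localPi E c N J v.1))) T _ hv, glue_apply_of_mem (fun v : {v // v ∉ S} => (UnitaryGroup.localInt E c N J v.1 : Set (UnitaryGroup.localPi E c N J v.1))) T _ hv, inv_mul_cancel]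
      exact (UnitaryGroup.localInt E c N J v.1).one_mem
    · rw [hy₁, glue_apply_of_not_mem (fun v : {v // v ∉ S} => (UnitaryGroup.localInt E c N J v.1 : Set (UnitaryGroup.localPi E c N J v.1))) T _ hv, glue_apply_of_not_mem (fun v : {v // v ∉ S} => (UnitaryGroup.localInt E c N J v.1 : Set (UnitaryGroup.localPi E c N J v.1))) T _ hv]
      dsimp only
      rw [inv_one, one_mul]
      exact (k ⟨v, hv⟩).2
  have hfac : glue (fun v : {v // v ∉ S} => (UnitaryGroup.localInt E c N J v.1 : Set (UnitaryGroup.localPi E c N J v.1))) T (w, k) = y₁ * (y₁⁻¹ * glue (fun v : {v // v ∉ S} => (UnitaryGroup.localInt E c N J v.1 : Set (UnitaryGroup.localPi E c N J v.1))) T (w, k)) := (mul_inv_cancel_left _ _).symm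
  rw [hfac, jY_mul, ← mul_assoc, apply_mul_jY_eq_of_forall_mem F E c N J S Q hK _ hz]

set_option maxHeartbeats 800000 in -- measured: > 200 000 (transport of `Measure.pi` along `T ≃ T.map val`, dependent products); no search tactics
omit [∀ v, BorelSpace (UnitaryGroup.localPi E c N J v)] in
/-- **The iterated Hecke identities over a finite set `T` of places OUTSIDE `S`** (★ (A) `integral_prod_mul_eq`, transported along the bijection
`T ≃ T.map val` of index types; Mathlib `measurePreserving_piCongrLeft`). [cite: CasselsFrohlichANT1967, Ch. XV (Tate) §3.3 Thm. 3.3.1] [cite: Liu2011, §2B Prop. 2.3 p. 862] -/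
theorem integral_prod_mul_eq_subtype (Q : (UnitaryGroup.adelicGroupData F E c N J).Adelic → ℂ) (hQm : Measurable Q) {CQ : ℝ} (hQb : ∀ g, ‖Q g‖ ≤ CQ)
    (νv : ∀ v : HeightOneSpectrum (𝓞 F), Measure (UnitaryGroup.localPi E c N J v)) [∀ v, SigmaFinite (νv v)]
    (Λ : ∀ v : HeightOneSpectrum (𝓞 F), UnitaryGroup.localPi E c N J v → ℂ) (cv : HeightOneSpectrum (𝓞 F) → ℂ)
    (hΛint : ∀ v, v ∉ S → Integrable (Λ v) (νv v))
    (hE : ∀ v, v ∉ S → ∀ t : (UnitaryGroup.adelicGroupData F E c N J).Adelic, ∫ g, Λ v g * Q (t * UnitaryGroup.inclPlaceAdelic F E c N J v g) ∂(νv v) = cv v * Q t)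
    (T : Finset {v : HeightOneSpectrum (𝓞 F) // v ∉ S})
    (emb : (Π v : {v : {v : HeightOneSpectrum (𝓞 F) // v ∉ S} // v ∈ T}, UnitaryGroup.localPi E c N J v.1.1) → (UnitaryGroup.adelicGroupData F E c N J).Adelic) (hemb : Measurable emb)
    (harch : ∀ w, UnitaryGroup.archPart F E c N J (emb w) = 1)
    (hin : ∀ w (v : {v : {v : HeightOneSpectrum (𝓞 F) // v ∉ S} // v ∈ T}), UnitaryGroup.evalPlace F E c N J v.1.1 (UnitaryGroup.finPart F E c N J (emb w)) = w v)
    (hout : ∀ w (v : HeightOneSpectrum (𝓞 F)), (∀ u : {v : {v : HeightOneSpectrum (𝓞 F) // v ∉ S} // v ∈ T}, u.1.1 ≠ v) →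
      UnitaryGroup.evalPlace F E c N J v (UnitaryGroup.finPart F E c N J (emb w)) = 1)
    (t : (UnitaryGroup.adelicGroupData F E c N J).Adelic) :
    ∫ w, (∏ v : {v : {v : HeightOneSpectrum (𝓞 F) // v ∉ S} // v ∈ T}, Λ v.1.1 (w v)) * Q (t * emb w)
        ∂(Measure.pi fun v : {v : {v : HeightOneSpectrum (𝓞 F) // v ∉ S} // v ∈ T} => νv v.1.1) = (∏ v ∈ T, cv v.1) * Q t := by
  classical
  -- the image finset `T♭ = T.map val` and the bijection `eT : T ≃ T♭`
  obtain ⟨Tb, hTb⟩ : ∃ Tb : Finset (HeightOneSpectrum (𝓞 F)), Tb = T.map (Function.Embedding.subtype fun v : HeightOneSpectrum (𝓞 F) => v ∉ S) :=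
    ⟨_, rfl⟩
  have hmemTb : ∀ v : HeightOneSpectrum (𝓞 F), v ∈ Tb ↔ ∃ h : v ∉ S, (⟨v, h⟩ : {v : HeightOneSpectrum (𝓞 F) // v ∉ S}) ∈ T := fun v => by
    rw [hTb, Finset.mem_map]
    constructor
    · rintro ⟨a, ha, rfl⟩; exact ⟨a.2, ha⟩
    · rintro ⟨h, hv⟩; exact ⟨⟨v, h⟩, hv, rfl⟩
  have hch : ∀ u : Tb, ∃ h : u.1 ∉ S, (⟨u.1, h⟩ : {v : HeightOneSpectrum (𝓞 F) // v ∉ S}) ∈ T := fun u => (hmemTb _).1 u.2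
  let eT : {v : {v : HeightOneSpectrum (𝓞 F) // v ∉ S} // v ∈ T} ≃ Tb :=
    { toFun := fun v => ⟨v.1.1, (hmemTb _).2 ⟨v.1.2, v.2⟩⟩
      invFun := fun u => ⟨⟨u.1, (hch u).choose⟩, (hch u).choose_spec⟩
      left_inv := fun v => rfl
      right_inv := fun u => rfl }
  -- the transported embedding and the data for ★ (A)
  have hsub : ∀ v ∈ Tb, v ∉ S := fun v hv => ((hmemTb _).1 hv).1
  have hmp := measurePreserving_piCongrLeft (fun u : Tb => νv u.1) eT
  have key := integral_prod_mul_eq F E c N J Q νv Λ cv hQm hQb Tb (fun v hv => hΛint v (hsub v hv)) (fun v hv => hE v (hsub v hv))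
    (fun u => emb fun v => u (eT v)) (hemb.comp (measurable_pi_lambda _ fun v => measurable_pi_apply (eT v))) (fun u => harch _)
    (fun u u' => by
      obtain ⟨v, rfl⟩ := eT.surjective u'
      exact hin (fun v => u (eT v)) v)
    (fun u v hv => hout _ v fun u' huv => hv (huv ▸ (eT u').2)) t
  have hprod : ∏ v ∈ Tb, cv v = ∏ v ∈ T, cv v.1 := by rw [hTb, Finset.prod_map]; rfl
  rw [hprod] at key
  rw [← key, ← hmp.integral_comp']
  refine integral_congr_ae (Filter.Eventually.of_forall fun w => ?_)
  dsimp only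
  rw [MeasurableEquiv.coe_piCongrLeft]
  have hprodw : (∏ u : Tb, Λ u.1 (Equiv.piCongrLeft (fun u : Tb => (UnitaryGroup.localPi E c N J u.1 : Type)) eT w u)) =
      ∏ v : {v : {v : HeightOneSpectrum (𝓞 F) // v ∉ S} // v ∈ T}, Λ v.1.1 (w v) :=
    (Fintype.prod_equiv eT (fun v => Λ v.1.1 (w v)) _ (fun v => by rw [Equiv.piCongrLeft_apply_apply]; rfl)).symm
  have hembw : (emb fun v => Equiv.piCongrLeft (fun u : Tb => (UnitaryGroup.localPi E c N J u.1 : Type)) eT w (eT v)) = emb w :=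
    congrArg emb (funext fun v => Equiv.piCongrLeft_apply_apply _ _ _ _)
  rw [hprodw, hembw]

set_option maxHeartbeats 800000 in -- measured: > 200 000 (restricted-product box bookkeeping); no search tactics
/-- **THE BOX FORMULA.**  `Q : U(J)(𝔸_F) → ℂ` bounded measurable with the right-invariance (K) under the compact factor off `S`; local Haar measures `ν_v` with
`ν_v(K_v) = 1` off `S`; kernels `Λ_v ∈ L¹(ν_v)`, `Λ_v|K_v = 1`, and the local Hecke identities (E) `∫ Λ_v(g) Q(t ι_v(g)) dν_v = c_v Q(t)` off `S`.  Then for every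
finite set `T` of places outside `S` and every `t`:  `∫_{A_T} (∏ᶠ_v Λ_v(y_v)) Q(t · j(y)) d∏'(ν_v; K_v)(y) = (∏_{v∈T} c_v) Q(t)`  (`A_T` = `Π_{v∈T} U(J)(F_v) × Π_{v∉T} K_v`
in `∏'_{v∉S}`; ★ `integral_comp_glue_prod`: the box is the image of `(Π_{v∈T} ν_v) ⊗ ρ_T` with `ρ_T` a probability, the `ρ_T`-part is killed by (K) (`apply_glue_eq`), and what is
left is `integral_prod_mul_eq_subtype`). [cite: CasselsFrohlichANT1967, Ch. XV (Tate) §3.3 Thm. 3.3.1] [cite: Liu2011, §2B Prop. 2.3 p. 862] -/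
theorem setIntegral_rpBox_eq (Q : (UnitaryGroup.adelicGroupData F E c N J).Adelic → ℂ) (hQm : Measurable Q) {CQ : ℝ} (hQb : ∀ g, ‖Q g‖ ≤ CQ)
    (hK : ∀ t k : (UnitaryGroup.adelicGroupData F E c N J).Adelic, UnitaryGroup.archPart F E c N J k = 1 →
      (∀ v, UnitaryGroup.evalPlace F E c N J v (UnitaryGroup.finPart F E c N J k) ∈ UnitaryGroup.localInt E c N J v) →
      (∀ v ∈ S, UnitaryGroup.evalPlace F E c N J v (UnitaryGroup.finPart F E c N J k) = 1) → Q (t * k) = Q t)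
    (νv : ∀ v : HeightOneSpectrum (𝓞 F), Measure (UnitaryGroup.localPi E c N J v)) [∀ v, (νv v).IsHaarMeasure]
    (hνK : ∀ v, v ∉ S → νv v (UnitaryGroup.localInt E c N J v : Set (UnitaryGroup.localPi E c N J v)) = 1)
    (Λ : ∀ v : HeightOneSpectrum (𝓞 F), UnitaryGroup.localPi E c N J v → ℂ) (hΛK : ∀ v, v ∉ S → ∀ k ∈ UnitaryGroup.localInt E c N J v, Λ v k = 1)
    (hΛint : ∀ v, v ∉ S → Integrable (Λ v) (νv v)) (cv : HeightOneSpectrum (𝓞 F) → ℂ)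
    (hE : ∀ v, v ∉ S → ∀ t : (UnitaryGroup.adelicGroupData F E c N J).Adelic, ∫ g, Λ v g * Q (t * UnitaryGroup.inclPlaceAdelic F E c N J v g) ∂(νv v) = cv v * Q t)
    (T : Finset {v : HeightOneSpectrum (𝓞 F) // v ∉ S}) (t : (UnitaryGroup.adelicGroupData F E c N J).Adelic) :
    ∫ y in rpBox (fun v : {v // v ∉ S} => (UnitaryGroup.localInt E c N J v.1 : Set (UnitaryGroup.localPi E c N J v.1))) T, (∏ᶠ v : {v : HeightOneSpectrum (𝓞 F) // v ∉ S}, Λ v.1 (y v)) *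
        Q (t * UnitaryGroup.finAdelicToAdelic F E c N J ((splitPlaces F E c N J S).symm (1, y)))
      ∂(rpMeasure (fun v : {v // v ∉ S} => (UnitaryGroup.localInt E c N J v.1 : Set (UnitaryGroup.localPi E c N J v.1))) (fun v => νv v.1) ∅) = (∏ v ∈ T, cv v.1) * Q t := by
  haveI : Countable (HeightOneSpectrum (𝓞 F)) := countable_heightOneSpectrum F
  haveI : ∀ v, SecondCountableTopology (UnitaryGroup.localPi E c N J v) := fun v => UnitaryGroup.secondCountableTopology_localPi E N c J v
  haveI : ∀ v, LocallyCompactSpace (UnitaryGroup.localPi E c N J v) := fun v => UnitaryGroup.locallyCompactSpace_localPi E N c J v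
  haveI := fact_isOpen_off (fun v => UnitaryGroup.localPi E c N J v) (fun v => UnitaryGroup.localInt E c N J v) S
  haveI := borelSpace_off (fun v => UnitaryGroup.localPi E c N J v) (fun v => UnitaryGroup.localInt E c N J v) S
  haveI := secondCountableTopology_off (fun v => UnitaryGroup.localPi E c N J v) (fun v => UnitaryGroup.localInt E c N J v) S
  haveI : ∀ v, SigmaFinite (νv v) := fun v => inferInstance
  haveI hS2 : SecondCountableTopology (Π v : S, UnitaryGroup.localPi E c N J v.1) := inferInstance
  haveI : SecondCountableTopologyEither (Π v : S, UnitaryGroup.localPi E c N J v.1) (Πʳ v : {v // v ∉ S}, [UnitaryGroup.localPi E c N J v.1, UnitaryGroup.localInt E c N J v.1]) := secondCountableTopologyEither_of_left _ _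
  haveI : BorelSpace ((Π v : S, UnitaryGroup.localPi E c N J v.1) × (Πʳ v : {v // v ∉ S}, [UnitaryGroup.localPi E c N J v.1, UnitaryGroup.localInt E c N J v.1])) := Prod.borelSpace
  have hKne : ∀ v : {v : HeightOneSpectrum (𝓞 F) // v ∉ S}, ((fun v : {v // v ∉ S} => (UnitaryGroup.localInt E c N J v.1 : Set (UnitaryGroup.localPi E c N J v.1))) v).Nonempty := fun v => ⟨1, (UnitaryGroup.localInt E c N J v.1).one_mem⟩
  have hKm : ∀ v : {v : HeightOneSpectrum (𝓞 F) // v ∉ S}, MeasurableSet ((fun v : {v // v ∉ S} => (UnitaryGroup.localInt E c N J v.1 : Set (UnitaryGroup.localPi E c N J v.1))) v) := fun v => (UnitaryGroup.isOpen_localInt E c N J v.1).measurableSet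
  have hK1 : ∀ v : {v : HeightOneSpectrum (𝓞 F) // v ∉ S}, v ∉ (∅ : Finset {v : HeightOneSpectrum (𝓞 F) // v ∉ S}) → νv v.1 ((fun v : {v // v ∉ S} => (UnitaryGroup.localInt E c N J v.1 : Set (UnitaryGroup.localPi E c N J v.1))) v) = 1 := fun v _ => hνK v.1 v.2
  haveI hρ := isProbabilityMeasure_rho (fun v : {v // v ∉ S} => (UnitaryGroup.localInt E c N J v.1 : Set (UnitaryGroup.localPi E c N J v.1))) (fun v => νv v.1) hKne hKm T
  haveI hρ1 : IsFiniteMeasure (rho (fun v : {v // v ∉ S} => (UnitaryGroup.localInt E c N J v.1 : Set (UnitaryGroup.localPi E c N J v.1))) (fun v => νv v.1) hKne T) :=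
    IsZeroOrProbabilityMeasure.toIsFiniteMeasure _
  haveI hρ2 : SigmaFinite (rho (fun v : {v // v ∉ S} => (UnitaryGroup.localInt E c N J v.1 : Set (UnitaryGroup.localPi E c N J v.1))) (fun v => νv v.1) hKne T) := IsFiniteMeasure.toSigmaFinite _
  haveI hρ3 : SFinite (rho (fun v : {v // v ∉ S} => (UnitaryGroup.localInt E c N J v.1 : Set (UnitaryGroup.localPi E c N J v.1))) (fun v => νv v.1) hKne T) := instSFiniteOfSigmaFinite
  rw [← integral_comp_glue_prod (fun v : {v // v ∉ S} => (UnitaryGroup.localInt E c N J v.1 : Set (UnitaryGroup.localPi E c N J v.1))) (fun v => νv v.1) hKne hKm hK1 (Finset.empty_subset T)]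
  -- the `K`-part of the box is invisible
  obtain ⟨k₁, hk₁⟩ : ∃ k₁ : Π v : {v : {v : HeightOneSpectrum (𝓞 F) // v ∉ S} // v ∉ T}, (fun v : {v // v ∉ S} => (UnitaryGroup.localInt E c N J v.1 : Set (UnitaryGroup.localPi E c N J v.1))) v.1, ∀ v, ((k₁ v : UnitaryGroup.localPi E c N J v.1.1)) = 1 :=
    ⟨fun v => ⟨1, (UnitaryGroup.localInt E c N J v.1.1).one_mem⟩, fun _ => rfl⟩
  obtain ⟨emb, hemb⟩ : ∃ emb : (Π v : {v : {v : HeightOneSpectrum (𝓞 F) // v ∉ S} // v ∈ T}, UnitaryGroup.localPi E c N J v.1.1) → (UnitaryGroup.adelicGroupData F E c N J).Adelic,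
      ∀ w, emb w = UnitaryGroup.finAdelicToAdelic F E c N J ((splitPlaces F E c N J S).symm (1, glue (fun v : {v // v ∉ S} => (UnitaryGroup.localInt E c N J v.1 : Set (UnitaryGroup.localPi E c N J v.1))) T (w, k₁))) := ⟨_, fun _ => rfl⟩
  obtain ⟨G, hG⟩ : ∃ G : (Π v : {v : {v : HeightOneSpectrum (𝓞 F) // v ∉ S} // v ∈ T}, UnitaryGroup.localPi E c N J v.1.1) → ℂ, ∀ w, G w = (∏ v : {v : {v : HeightOneSpectrum (𝓞 F) // v ∉ S} // v ∈ T}, Λ v.1.1 (w v)) * Q (t * emb w) := ⟨_, fun _ => rfl⟩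
  have hk₁' : k₁ = fun v => ⟨1, (UnitaryGroup.localInt E c N J v.1.1).one_mem⟩ := funext fun v => Subtype.ext (hk₁ v)
  have hpt : ∀ p : (Π v : {v : {v : HeightOneSpectrum (𝓞 F) // v ∉ S} // v ∈ T}, UnitaryGroup.localPi E c N J v.1.1) × (Π v : {v : {v : HeightOneSpectrum (𝓞 F) // v ∉ S} // v ∉ T}, (fun v : {v // v ∉ S} => (UnitaryGroup.localInt E c N J v.1 : Set (UnitaryGroup.localPi E c N J v.1))) v.1),
      (∏ᶠ v : {v : HeightOneSpectrum (𝓞 F) // v ∉ S}, Λ v.1 (glue (fun v : {v // v ∉ S} => (UnitaryGroup.localInt E c N J v.1 : Set (UnitaryGroup.localPi E c N J v.1))) T p v)) *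
        Q (t * UnitaryGroup.finAdelicToAdelic F E c N J ((splitPlaces F E c N J S).symm (1, glue (fun v : {v // v ∉ S} => (UnitaryGroup.localInt E c N J v.1 : Set (UnitaryGroup.localPi E c N J v.1))) T p))) = G p.1 := by
    rintro ⟨w, k⟩
    rw [hG, hemb, hk₁', finprod_glue_eq F E c N J S Λ hΛK T (w, k), apply_glue_eq F E c N J S Q hK T w k t]
  simp_rw [hpt]
  have hfst := integral_fun_fst (μ := Measure.pi fun v : {v : {v : HeightOneSpectrum (𝓞 F) // v ∉ S} // v ∈ T} => νv v.1.1)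
    (ν := rho (fun v : {v // v ∉ S} => (UnitaryGroup.localInt E c N J v.1 : Set (UnitaryGroup.localPi E c N J v.1))) (fun v => νv v.1) hKne T) G
  rw [hfst, probReal_univ, one_smul]
  simp_rw [hG]
  -- the iterated Hecke identities for the `T`-embedding `emb`
  have hjc : Continuous fun y : (Πʳ v : {v // v ∉ S}, [UnitaryGroup.localPi E c N J v.1, UnitaryGroup.localInt E c N J v.1]) => UnitaryGroup.finAdelicToAdelic F E c N J ((splitPlaces F E c N J S).symm (1, y)) :=
    (UnitaryGroup.continuous_finAdelicToAdelic F E c N J).comp ((splitPlaces F E c N J S).symm.continuous.comp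
      (continuous_const.prodMk continuous_id))
  have hemb' : emb = fun w => UnitaryGroup.finAdelicToAdelic F E c N J ((splitPlaces F E c N J S).symm (1, glue (fun v : {v // v ∉ S} => (UnitaryGroup.localInt E c N J v.1 : Set (UnitaryGroup.localPi E c N J v.1))) T (w, k₁))) :=
    funext hemb
  refine integral_prod_mul_eq_subtype F E c N J S Q hQm hQb νv Λ cv hΛint hE T emb
    (by rw [hemb']; exact hjc.measurable.comp ((measurable_glue (fun v : {v // v ∉ S} => (UnitaryGroup.localInt E c N J v.1 : Set (UnitaryGroup.localPi E c N J v.1))) hKm T).comp (measurable_id.prodMk measurable_const)))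
    (fun w => by rw [hemb]; exact UnitaryGroup.archPart_finAdelicToAdelic F E c N J _) (fun w v => ?_) (fun w v hv => ?_) t
  · rw [hemb, UnitaryGroup.finPart_finAdelicToAdelic, evalPlace_splitPlaces_symm_of_not_mem, glue_apply_of_mem (fun v : {v // v ∉ S} => (UnitaryGroup.localInt E c N J v.1 : Set (UnitaryGroup.localPi E c N J v.1))) T _ v.2]
  · rw [hemb, UnitaryGroup.finPart_finAdelicToAdelic]
    by_cases hvS : v ∈ S
    · rw [evalPlace_splitPlaces_symm_of_mem F E c N J S 1 _ ⟨v, hvS⟩, Pi.one_apply]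
    · have hvT : (⟨v, hvS⟩ : {v : HeightOneSpectrum (𝓞 F) // v ∉ S}) ∉ T := fun h => hv ⟨⟨v, hvS⟩, h⟩ rfl
      rw [evalPlace_splitPlaces_symm_of_not_mem F E c N J S 1 _ ⟨v, hvS⟩, glue_apply_of_not_mem (fun v : {v // v ∉ S} => (UnitaryGroup.localInt E c N J v.1 : Set (UnitaryGroup.localPi E c N J v.1))) T _ hvT]
      exact hk₁ _

end Box

end Summit.HodgeConjecture.HodgeConjecture.Cruxes.HLiu418.K2LiuDoublingEulerBox

end
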